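import Literature.NumberTheory.DiophantineGeometry.GenEllDeFamilyGoodPrimesOrd
import Literature.NumberTheory.DiophantineGeometry.FibreConductorJunction
import HarnessLib

/-!
# [GenEll] Thm. 2.1 on the `D_e` route, family `t_c`: the conductor slope `κ ≤ Bc·h(x) + c₂`

S. Mochizuki, *Arithmetic elliptic curves in general position*, Math. J. Okayama Univ. 52 (2010),
Prop. 1.6 p. 10 (reduced divisor) as used in the proof of Thm. 2.1 pp. 12–13
[cite: MochizukiGenEll2010, Prop 1.6 p.10]. Support file for the route item `GenEllTwo` (stmt-ABC-19679),
W5 coordinator abc-iut-w5-d045; classical, nothing here bears on [IUTchIII] Cor. 3.12.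

The KERNEL JUNCTION of the W5 package for the family `t_c = 1/r + c·r^{k+1}/s`: the good-place analysis on
`D_e` (`DeC.ord_placewise_of_gap`, this seat) plugged into the summation/slope assembly over all places
(`FibreConductor.inv_finrank_mul_sum_logNorm_le_slope_of_dichotomy`, abc-iut-w5-d009). For a point
`(r, s, t)` of `D_e` over a number field `L` with `t = t_c`, `N = N_c ≠ 0`, `t ∉ B`, a finite bad set `Sbad`
off which `2`, `c`, `B` and the fibre polynomials `G^c_b` have good reduction and the converse direction
holds, a finite set `W` of places meeting `B` off `Sbad`, and the analytic/height inputs at the bad and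
archimedean places (`hbad₁`, `hbad₂`, `harch`: packages W5b/W5c; `ht`, `hN`: W4a; `hB`: the values), one
gets VERBATIM the `hκ`-shape bound of the mechanism theorem `vojtaIneq_of_belyi_mechanism`:

  `(1/[L:ℚ]) Σ_{w∈W} log N(w) ≤ ((|B|(2k+4) − (6k+6))/(2k+1)) · (1/[L:ℚ]) h_L(x) + const`.
-/

noncomputable section

namespace Literature.NumberTheory.DiophantineGeometry.GenEll

open _root_.Polynomial NumberField IsDedekindDomain Real Height
open Literature.IUT.LogVolume

variable {L : Type*} [Field L] [NumberField L]

/-- **The conductor slope for the family `t_c` on `D_e`** ([GenEll] Prop. 1.6, sharp form, summed over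
all places): the good-place inequalities of `DeC.ord_placewise_of_gap` off `Sbad` together with the
bad-place, archimedean and height inputs give
`(1/[L:ℚ]) Σ_{w∈W} log N(w) ≤ ((|B|(2k+4) − (6k+6))/(2k+1))·(1/[L:ℚ])·h_L(x) + const` — the hypothesis `hκ` of
the mechanism bookkeeping `vojtaIneq_of_belyi_mechanism(_of_subset)` with
`Bc = ((|B|)(e+3) − 3e − 3)/e`, `e = 2k+1`. [cite: MochizukiGenEll2010, Prop 1.6 p.10] -/
theorem DeC.inv_finrank_mul_sum_logNorm_le_slope (k : ℕ) {c r s t N x : L}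
    (hcurve : s ^ 2 = 1 - 4 * r ^ (2 * k + 1)) (ht : t * (r * s) = s + c * r ^ (k + 2))
    (hN : N = -s ^ 3 + c * ((k + 1) * r ^ (k + 2) - 2 * r ^ (3 * k + 3))) (hN0 : N ≠ 0)
    (B : Finset L) (htB : ∀ b ∈ B, t ≠ b) (g : L → L[X])
    (hg : ∀ b ∈ B, g b = C (c ^ 2) * X ^ (2 * k + 4) + C (4 * b ^ 2) * X ^ (2 * k + 3)
      - C (8 * b) * X ^ (2 * k + 2) + C 4 * X ^ (2 * k + 1) - C (b ^ 2) * X ^ 2 + C (2 * b) * X - 1)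
    (Sbad W : Finset (HeightOneSpectrum (𝓞 L))) {C₁ C₂ C₃ C₄ C₅ C₆ : ℝ}
    (h2 : ∀ w, w ∉ Sbad → w.valuation L 2 = 1) (hc : ∀ w, w ∉ Sbad → w.valuation L c = 1)
    (hBint : ∀ w, w ∉ Sbad → ∀ b ∈ B, w.valuation L b ≤ 1)
    (hBsep : ∀ w, w ∉ Sbad → ∀ b ∈ B, ∀ b' ∈ B, b ≠ b' → w.valuation L (b - b') = 1)
    (hgap : ∀ w, w ∉ Sbad → ∀ b ∈ B, ∀ ρ : L, w.valuation L ρ ≤ 1 → (g b).eval ρ ≠ 0 →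
      w.valuation L ((g b).eval ρ) < 1 →
      w.valuation L ((g b).eval ρ) < w.valuation L ((derivative (g b)).eval ρ))
    (hconv : ∀ w, w ∉ Sbad → w.valuation L N < 1 → ∃ b ∈ B, w.valuation L (t - b) < 1)
    (hW : ∀ w ∈ W, w ∉ Sbad → ∃ b ∈ B, 0 < ord L w (t - b))
    (hbad₁ : ∑ w ∈ Sbad, ((ord L w N).toNat : ℝ) * logNorm L w ≤ Module.finrank ℚ L * C₁)
    (hbad₂ : ∑ w ∈ Sbad, logNorm L w ≤ Module.finrank ℚ L * C₂)
    (harch : ∀ v : InfinitePlace L, log⁺ (v N⁻¹) ≤ C₃)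
    (htH : (2 * k + 1 : ℝ) * logHeight₁ t ≤ (2 * k + 4 : ℝ) * logHeight₁ x + Module.finrank ℚ L * C₄)
    (hNH : (6 * k + 6 : ℝ) * logHeight₁ x ≤ (2 * k + 1 : ℝ) * logHeight₁ N + Module.finrank ℚ L * C₅)
    (hBH : ∀ b ∈ B, logHeight₁ b ≤ Module.finrank ℚ L * C₆) :
    (Module.finrank ℚ L : ℝ)⁻¹ * ∑ w ∈ W, logNorm L w ≤
      ((B.card * (2 * k + 4 : ℝ) - (6 * k + 6)) / (2 * k + 1)) *
          ((Module.finrank ℚ L : ℝ)⁻¹ * logHeight₁ x) +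
        ((B.card * C₄ + C₅) / (2 * k + 1) + B.card * (C₆ + Real.log 2) + C₁ + C₂ + C₃) :=
  FibreConductor.inv_finrank_mul_sum_logNorm_le_slope_of_dichotomy k x t N B W Sbad
    (fun w hw => DeC.ord_placewise_of_gap w k (h2 w hw) (hc w hw) hcurve ht hN hN0 B htB (hBint w hw)
      (hBsep w hw) g hg (hgap w hw) (hconv w hw))
    hW hbad₁ hbad₂ harch htH hNH hBH

end Literature.NumberTheory.DiophantineGeometry.GenEll
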